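import Summits.QuantumFields.BalabanUV.Beta.HessKerDressedUnitsWall

/-!
# `BalabanUV.Beta.HessKerFourFamily` — the wall's road-A2 END in DRESSING-AGNOSTIC («four-family») form, and its DIRECT form for
# ARBITRARY step jet data in arbitrary leg units (asymptotic lane asym1, gen 17, v1, part 1 of 3; part 2 = `AxialDressingRootedUnits`,
# part 3 = `HessKerRootedWall`)

HONEST FRAMING (cell contract, verbatim): «discharging `BetaPertH` makes Bałaban's UV stability UNCONDITIONAL — a real
constructive-QFT result; it is NOT the continuum limit and NOT the Clay problem.»  THIS MODULE re-poses the tree's road-A2 chain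
(`HessKerDressedCauchy` §2–§3, `HessKerDressedLimit` §2–§3, `HessKerDressedUnitsWall` §3) with the dressing ABSTRACTED AWAY; it formalises NO
statement printed in Bałaban's papers, cites none as a hypothesis, mints no `Prop` fact, instantiates NO binder of the β-function wall at a
value (RULING (R18-3): every kernel / stencil / table family, every constant and every unit sequence stays UNIVERSALLY BOUND) and DISCHARGES
NOTHING of it.  NOT summit progress.

ABSOLUTE RULE (cell, verbatim): «No internally-minted statement may enter as a cited fact. Every hypothesis is either
kernel-proved in this package or a verbatim quotation of a PUBLISHED theorem with page reference. The manuscript(s) under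
audit are NOT citable for their own disputed steps — they are the thing under adjudication; programme-internal
(2001/route/tribunal) claims are never citable.»  The data binders below ((CONV-C-Cauchy)-shaped rows on four families) are HYPOTHESIS
SHAPES with free constants, never asserted (located, NOT in print: O-asym1-1 of the lane memo).

PLACEMENT.  Cell result under the registered topic `Summits/QuantumFields/BalabanUV/Beta/` (β-lead (R34-2); ≤ 400 lines; theorems only).

WHY THIS LEAF.  Every wall-level END of the lane so far is stated over an2's CORNER-dressed literal `BalabanStepJetsSucc.JsBalOf` through the
closed form `TbalOf_JsBalOf` (`hessKer (Π K Π) (V^Π_K S) W`).  The ROOTED / CENTRED literal of route (α) (`SpineRooted.JsBalAtOf hLc hr … :=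
fun j ↦ AxialDressingRooted.dressAt hr (JsBal0AtOf … j)`, wall candidate v2.22) is NOT a `JsBalOf` instance, and other dressings may follow.
The estimates never used the dressing: the tree's bricks (`HessKerSchur.uniformDecay_hessKer_halfV` / `geometricRate_hessKer_halfV`,
`vertexFamilyW_vertexOfK[_rate]`) are stated for a triple `(A, V, W)` with `V = vertexOfK K N S`.  Here they are assembled ONCE for FOUR
INDEPENDENT families — the A-slot kernels `A_k`, the vertex kernels `K_k`, the stencils `S_k`, the tables `W_k` — with POINTWISE rows
(`Decays` / `LocStencil` / `VertexFamily₂`, `k`-uniform bounds + geometric deviations), and the wall END is derived for ANY step jet data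
`Js : ℕ → JetData 3 Lc` admitting a closed form `TbalOf Lc Js j = hessKer (A j) (vertexOfK (K j) Lc (S j)) (W j)`.  KEY OBSERVATION (§3): by
`OneStepKernelFamily.TstepOf` the wall's kernel IS such a form DEFINITIONALLY, `TbalOf Lc Js j = hessKer K_j (vertexOfK K_j Lc (Js j).S) (Js j).W`,
`K_j = KInvStep Lc j` — so for EVERY dressing the END follows from rows on `D_j K_j D_j` (the K-slot rows of `HessKerDressedUnitsWall`, i.e.
lane G-an2-4's currencies, UNCHANGED), on `unitS_j (Js j).S` and on `unitW_j (Js j).W` (the jet data's OWN stencils and tables, in any leg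
units): `d1Drift_iff_of_cauchy_self_unit`.  Part 2 transports those rows through the rooted dressing and states the END over `JsBalAtOf`.

CONTENT (no `def`, no `Prop`; every constant explicit; `|F| := Fintype.card (Fib d)`).
* §1 `hessKer_four_unit` — units invariance of the four-family kernel (part-1 units of `HessKerDressedUnits`, `HessKerRate.hessKer_scaleK`).
* §2 generic `d`, level `N`: `uniformDecay_hessKer_four` (UD, constant `hessW B_A B_V B_W`), `geometricRate_hessKer_four_lim` ((PR) against
  named limits, 8-slot `lipW B_A B_A B_V B_V B_W r_A r_V r_W`), `geomRate_secondMoment_hessKer_four_lim`, `limKernelOf_hessKer_four_apply`;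
  `B_A = |F|·C_A·Zl(δK−R)`, `B_V = |F|·C·Zl(δK−R)·(|F|²·Cs·Zl(δS−R/2)²)`, `B_W = |F|²·Cw·Zl(δW−R)²`, `r_A = |F|·c_A·Zl(δK−R)`,
  `r_V = |F|·c_K·Zl(δK−R)·(|F|²·Cs·Zl²) + |F|·C·Zl(δK−R)·(|F|²·c_S·Zl²)`, `r_W = |F|²·c_W·Zl(δW−R)²` (the tree's dressed constants with the
  dressing factors `cAx`, `cN'` removed — they re-enter through the rows of whoever dresses).
* §3 `d = 3`, ANY `Js` with a closed form `hT`: `geomRate_secondMoment_TbalOf_four_lim`, `allScalesSeq_secondMoment_TbalOf_four_lim` (explicit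
  `κ`, for `HessKerDressedCauchy.pos_of_ge`), **`d1Drift_iff_of_lim_four`**, **`d1Drift_iff_of_cauchy_four`** (constructed limits
  `limMKerOf A`, `limMKerOf K`, `limStOf S`, `limTabOf W`), `limKernelOf_TbalOf_apply_four`; the DIRECT form `TbalOf_apply[_unit]`,
  **`d1Drift_iff_of_cauchy_self_unit`** (any `Js`, any nonzero unit sequences).
CONSISTENCY.  At `A := axDressK Lc ∘ K`, `S := coProj Lc ∘ S♭`, `hT := TbalOf_JsBalOf` + `vertexOfK_coProj_eq` the §3 END is the tree's
`HessKerDressedUnitsWall.d1Drift_JsBalOf_iff_of_cauchy_unit` up to the bookkeeping of `cAx`/`cN'` inside `C_A`, `Cs` (not re-derived here).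
WHAT IS NOT HERE: any row for Bałaban's objects (suppliers: G-an2-4 for the K-slot, an1/an2 for stencils and tables); the identification of
the limit second moment with `stepBal N Lc` (O-asym1-7, D1-level); any numeric constant; `k₀`; `betaPertH_holds`.  NOT continuum, NOT Clay.
-/

open Finset Filter Topology
open scoped BigOperators
open Literature.MathematicalPhysics.QuantumFieldTheory.Balaban1983to89
open Literature.MathematicalPhysics.QuantumFieldTheory.Balaban1983to89.Beta
open B12Sec2to5 (betaPrime510)
open ExpKernelCalculus (MKer Decays BiLoc VertexFamily₂ hessKer Zl)
open LimitRate (limKernelOf)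
open HessKerRate (hessKer_scaleK)
open HessKerSchur (ColW VertexFamilyW VertexFamily₂W hessW lipW LocStencilW colW_of_decays locStencilW_of_locStencil
  vertexFamily₂W_of_vertexFamily₂ uniformDecay_hessKer_halfV geometricRate_hessKer_halfV vertexFamilyW_vertexOfK vertexFamilyW_vertexOfK_rate)
open RemainderConstAllScales (AllScalesSeq allScalesSeq_of_geomRate)
open RateCertificate (GeomRate CauchyRate)
open OneStepResolventKernel (Fib LocStencil JetData)
open OneStepKernelFamily (vertexOfK KInvStep TbalOf D1Drift)
open HessKerDressedCauchy (d1Drift_iff_lim_eq one_le_Lc)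
open HessKerDressedLimit (limMKerOf limStOf limTabOf decays_limMKerOf decays_sub_limMKerOf locStencil_limStOf locStencil_sub_limStOf
  vertexFamily₂_limTabOf vertexFamily₂_sub_limTabOf secondMoment_congr)
open Summit.QuantumFields.BalabanUV.Beta.HessKerDressedUnits

namespace Summit.QuantumFields.BalabanUV.Beta.HessKerFourFamily

/-! ## §1 Units invariance of the four-family kernel -/

section Units

variable {d : ℕ}

/-- [folklore] **UNITS INVARIANCE OF THE FOUR-FAMILY KERNEL**: for nonzero leg units,
`hessKer (D A D) (vertexOfK (D K D) N (unitS S)) (unitW W) = hessKer A (vertexOfK K N S) W` (`vertexOfK_unit`, `HessKerRate.hessKer_scaleK`;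
the tree's `hessKer_vertexOfK_unit` is the instance `A = K`). -/
theorem hessKer_four_unit {sf sm : ℝ} (hsf : sf ≠ 0) (hsm : sm ≠ 0) (N : ℕ) (A K : MKer (d + 1) (Fib d))
    (S : Fin (d + 1) → (Fin (d + 1) → ℤ) → MKer (d + 1) (Fib d))
    (W : Fin (d + 1) → (Fin (d + 1) → ℤ) → Fin (d + 1) → (Fin (d + 1) → ℤ) → MKer (d + 1) (Fib d)) :
    hessKer (unitK sf sm A) (vertexOfK (unitK sf sm K) N (unitS sf sm S)) (unitW sf sm W) = hessKer A (vertexOfK K N S) W := by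
  have hV : vertexOfK (unitK sf sm K) N (unitS sf sm S) = fun μ y => counitK sf sm (vertexOfK K N S μ y) :=
    funext fun μ => funext fun y => vertexOfK_unit hsf hsm K N S μ y
  rw [hV]
  exact hessKer_scaleK (legScale sf sm) (legScale sf⁻¹ sm⁻¹) (legScale_mul_legScale_inv hsf hsm) A (vertexOfK K N S) W

end Units

/-! ## §2 Generic `d`, level `N`: the family `k ↦ hessKer A_k (vertexOfK K_k N S_k) W_k` from POINTWISE rows on FOUR independent families -/

section Four

variable {d : ℕ}
variable {A K : ℕ → MKer (d + 1) (Fib d)} {Ainf Kinf : MKer (d + 1) (Fib d)}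
  {S : ℕ → Fin (d + 1) → (Fin (d + 1) → ℤ) → MKer (d + 1) (Fib d)} {Sinf : Fin (d + 1) → (Fin (d + 1) → ℤ) → MKer (d + 1) (Fib d)}
  {W : ℕ → Fin (d + 1) → (Fin (d + 1) → ℤ) → Fin (d + 1) → (Fin (d + 1) → ℤ) → MKer (d + 1) (Fib d)}
  {Winf : Fin (d + 1) → (Fin (d + 1) → ℤ) → Fin (d + 1) → (Fin (d + 1) → ℤ) → MKer (d + 1) (Fib d)}
  {R CA cA C cK δK Cs cS δS Cw cW δW θ : ℝ} {N : ℕ}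

/-- [folklore] **(UD) OF THE FOUR-FAMILY KERNEL from pointwise `k`-uniform rows** at any `0 < R < δK`, `R/2 < δS`, `R < δW`: constant
`hessW B_A B_V B_W` at rate `R·N` (`HessKerSchur.uniformDecay_hessKer_halfV` + `vertexFamilyW_vertexOfK`; the A-slot is asked at the K-rate). -/
theorem uniformDecay_hessKer_four (hA : ∀ k, Decays (A k) CA δK) (hK : ∀ k, Decays (K k) C δK)
    (hS : ∀ k, LocStencil (S k) Cs δS) (hW : ∀ k, VertexFamily₂ (W k) N Cw δW)
    (hR : 0 < R) (hRK : R < δK) (hRS : R / 2 < δS) (hRW : R < δW) (μ ν : Fin (d + 1)) :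
    LimitRate.UniformDecay (fun k => hessKer (A k) (vertexOfK (K k) N (S k)) (W k)) μ ν
      (hessW ((Fintype.card (Fib d) : ℝ) * CA * Zl (d + 1) (δK - R))
        ((Fintype.card (Fib d) : ℝ) * C * Zl (d + 1) (δK - R) * ((Fintype.card (Fib d) : ℝ) ^ 2 * Cs * Zl (d + 1) (δS - R / 2) ^ 2))
        ((Fintype.card (Fib d) : ℝ) ^ 2 * Cw * Zl (d + 1) (δW - R) ^ 2))
      (R * N) :=
  uniformDecay_hessKer_halfV (V := fun k => vertexOfK (K k) N (S k)) (fun k => colW_of_decays (hA k) hRK)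
    (fun k => vertexFamilyW_vertexOfK (colW_of_decays (hK k) hRK) (locStencilW_of_locStencil (hS k) hRS) hR N)
    (fun k => vertexFamily₂W_of_vertexFamily₂ (hW k) hRW) hR.le μ ν

/-- [folklore] **(PR) OF THE FOUR-FAMILY KERNEL AGAINST NAMED LIMITS** `(A∞, K∞, S∞, W∞)`: `k`-uniform pointwise rows on the four families, the
SAME rows on the limits, and deviations `Decays (A k − A∞) (c_A θ^k) δK`, `Decays (K k − K∞) (c_K θ^k) δK`, `LocStencil (S k − S∞) (c_S θ^k) δS`,
`VertexFamily₂ (W k − W∞) N (c_W θ^k) δW` ⟹ `GeometricRate (k ↦ hessKer A_k (vertexOfK K_k N S_k) W_k) (hessKer A∞ (vertexOfK K∞ N S∞) W∞) μ ν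
(lipW B_A B_A B_V B_V B_W r_A r_V r_W) (R·N) θ` (`HessKerSchur.geometricRate_hessKer_halfV` + `vertexFamilyW_vertexOfK_rate`).  NO range of `θ`. -/
theorem geometricRate_hessKer_four_lim
    (hA : ∀ k, Decays (A k) CA δK) (hAinf : Decays Ainf CA δK) (hArate : ∀ k, Decays (A k - Ainf) (cA * θ ^ k) δK)
    (hK : ∀ k, Decays (K k) C δK) (hKinf : Decays Kinf C δK) (hKrate : ∀ k, Decays (K k - Kinf) (cK * θ ^ k) δK)
    (hS : ∀ k, LocStencil (S k) Cs δS) (hSinf : LocStencil Sinf Cs δS) (hSrate : ∀ k, LocStencil (S k - Sinf) (cS * θ ^ k) δS)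
    (hW : ∀ k, VertexFamily₂ (W k) N Cw δW) (hWinf : VertexFamily₂ Winf N Cw δW)
    (hWrate : ∀ k, VertexFamily₂ (W k - Winf) N (cW * θ ^ k) δW)
    (hR : 0 < R) (hRK : R < δK) (hRS : R / 2 < δS) (hRW : R < δW) (μ ν : Fin (d + 1)) :
    LimitRate.GeometricRate (fun k => hessKer (A k) (vertexOfK (K k) N (S k)) (W k)) (hessKer Ainf (vertexOfK Kinf N Sinf) Winf) μ ν
      (lipW ((Fintype.card (Fib d) : ℝ) * CA * Zl (d + 1) (δK - R))
        ((Fintype.card (Fib d) : ℝ) * CA * Zl (d + 1) (δK - R))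
        ((Fintype.card (Fib d) : ℝ) * C * Zl (d + 1) (δK - R) * ((Fintype.card (Fib d) : ℝ) ^ 2 * Cs * Zl (d + 1) (δS - R / 2) ^ 2))
        ((Fintype.card (Fib d) : ℝ) * C * Zl (d + 1) (δK - R) * ((Fintype.card (Fib d) : ℝ) ^ 2 * Cs * Zl (d + 1) (δS - R / 2) ^ 2))
        ((Fintype.card (Fib d) : ℝ) ^ 2 * Cw * Zl (d + 1) (δW - R) ^ 2)
        ((Fintype.card (Fib d) : ℝ) * cA * Zl (d + 1) (δK - R))
        ((Fintype.card (Fib d) : ℝ) * cK * Zl (d + 1) (δK - R) * ((Fintype.card (Fib d) : ℝ) ^ 2 * Cs * Zl (d + 1) (δS - R / 2) ^ 2) +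
          (Fintype.card (Fib d) : ℝ) * C * Zl (d + 1) (δK - R) * ((Fintype.card (Fib d) : ℝ) ^ 2 * cS * Zl (d + 1) (δS - R / 2) ^ 2))
        ((Fintype.card (Fib d) : ℝ) ^ 2 * cW * Zl (d + 1) (δW - R) ^ 2))
      (R * N) θ := by
  -- the A-slot
  have hA' : ∀ k, ColW (A k) R ((Fintype.card (Fib d) : ℝ) * CA * Zl (d + 1) (δK - R)) := fun k => colW_of_decays (hA k) hRK
  have hAinf' : ColW Ainf R ((Fintype.card (Fib d) : ℝ) * CA * Zl (d + 1) (δK - R)) := colW_of_decays hAinf hRK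
  have hArate' : ∀ k, ColW (A k - Ainf) R ((Fintype.card (Fib d) : ℝ) * cA * Zl (d + 1) (δK - R) * θ ^ k) := fun k =>
    (colW_of_decays (hArate k) hRK).mono (le_of_eq (by ring))
  -- the V-slot: `K`-columns against the stencils
  have hKW : ∀ k, ColW (K k) R ((Fintype.card (Fib d) : ℝ) * C * Zl (d + 1) (δK - R)) := fun k => colW_of_decays (hK k) hRK
  have hKWinf : ColW Kinf R ((Fintype.card (Fib d) : ℝ) * C * Zl (d + 1) (δK - R)) := colW_of_decays hKinf hRK
  have hKWrate : ∀ k, ColW (K k - Kinf) R ((Fintype.card (Fib d) : ℝ) * cK * Zl (d + 1) (δK - R) * θ ^ k) := fun k =>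
    (colW_of_decays (hKrate k) hRK).mono (le_of_eq (by ring))
  have hSW : ∀ k, LocStencilW (S k) (R / 2) ((Fintype.card (Fib d) : ℝ) ^ 2 * Cs * Zl (d + 1) (δS - R / 2) ^ 2) :=
    fun k => locStencilW_of_locStencil (hS k) hRS
  have hSWinf : LocStencilW Sinf (R / 2) ((Fintype.card (Fib d) : ℝ) ^ 2 * Cs * Zl (d + 1) (δS - R / 2) ^ 2) :=
    locStencilW_of_locStencil hSinf hRS
  have hSWrate : ∀ k, LocStencilW (S k - Sinf) (R / 2) (((Fintype.card (Fib d) : ℝ) ^ 2 * cS * Zl (d + 1) (δS - R / 2) ^ 2) * θ ^ k) :=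
    fun k => (locStencilW_of_locStencil (hSrate k) hRS).mono (le_of_eq (by ring))
  have hV := fun k => vertexFamilyW_vertexOfK (hKW k) (hSW k) hR N
  have hVinf := vertexFamilyW_vertexOfK hKWinf hSWinf hR N
  have hVrate := fun k => vertexFamilyW_vertexOfK_rate hKW hKWinf hKWrate hSW hSWinf hSWrate hR N k
  -- the W-slot
  have hWW : ∀ k, VertexFamily₂W (W k) N R ((Fintype.card (Fib d) : ℝ) ^ 2 * Cw * Zl (d + 1) (δW - R) ^ 2) :=
    fun k => vertexFamily₂W_of_vertexFamily₂ (hW k) hRW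
  have hWWinf : VertexFamily₂W Winf N R ((Fintype.card (Fib d) : ℝ) ^ 2 * Cw * Zl (d + 1) (δW - R) ^ 2) :=
    vertexFamily₂W_of_vertexFamily₂ hWinf hRW
  have hWWrate : ∀ k, VertexFamily₂W (W k - Winf) N R ((Fintype.card (Fib d) : ℝ) ^ 2 * cW * Zl (d + 1) (δW - R) ^ 2 * θ ^ k) :=
    fun k => (vertexFamily₂W_of_vertexFamily₂ (hWrate k) hRW).mono (le_of_eq (by ring))
  exact geometricRate_hessKer_halfV (V := fun k => vertexOfK (K k) N (S k)) (Vinf := vertexOfK Kinf N Sinf) hA' hAinf' hArate' hV hVinf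
    hVrate hWW hWWinf hWWrate hR μ ν

/-- [folklore] **(SW1)-SHAPE END OF THE FOUR-FAMILY KERNEL AGAINST NAMED LIMITS** (`1 ≤ N`): `GeomRate` of the second moments TO
`secondMoment (hessKer A∞ (vertexOfK K∞ N S∞) W∞) μ ν`, `c₀ = betaPrime510 (d+1) (lipW …) (R·N)` EXPLICIT (`LimitRate.abs_secondMoment_sub_limit_le`
on (UD) + (PR)).  NO range of `θ`. -/
theorem geomRate_secondMoment_hessKer_four_lim (hN : 1 ≤ N)
    (hA : ∀ k, Decays (A k) CA δK) (hAinf : Decays Ainf CA δK) (hArate : ∀ k, Decays (A k - Ainf) (cA * θ ^ k) δK)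
    (hK : ∀ k, Decays (K k) C δK) (hKinf : Decays Kinf C δK) (hKrate : ∀ k, Decays (K k - Kinf) (cK * θ ^ k) δK)
    (hS : ∀ k, LocStencil (S k) Cs δS) (hSinf : LocStencil Sinf Cs δS) (hSrate : ∀ k, LocStencil (S k - Sinf) (cS * θ ^ k) δS)
    (hW : ∀ k, VertexFamily₂ (W k) N Cw δW) (hWinf : VertexFamily₂ Winf N Cw δW)
    (hWrate : ∀ k, VertexFamily₂ (W k - Winf) N (cW * θ ^ k) δW)
    (hR : 0 < R) (hRK : R < δK) (hRS : R / 2 < δS) (hRW : R < δW) (μ ν : Fin (d + 1)) :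
    GeomRate (fun k => B12Beta.secondMoment (hessKer (A k) (vertexOfK (K k) N (S k)) (W k)) μ ν)
      (B12Beta.secondMoment (hessKer Ainf (vertexOfK Kinf N Sinf) Winf) μ ν)
      (betaPrime510 (d + 1)
        (lipW ((Fintype.card (Fib d) : ℝ) * CA * Zl (d + 1) (δK - R))
          ((Fintype.card (Fib d) : ℝ) * CA * Zl (d + 1) (δK - R))
          ((Fintype.card (Fib d) : ℝ) * C * Zl (d + 1) (δK - R) * ((Fintype.card (Fib d) : ℝ) ^ 2 * Cs * Zl (d + 1) (δS - R / 2) ^ 2))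
          ((Fintype.card (Fib d) : ℝ) * C * Zl (d + 1) (δK - R) * ((Fintype.card (Fib d) : ℝ) ^ 2 * Cs * Zl (d + 1) (δS - R / 2) ^ 2))
          ((Fintype.card (Fib d) : ℝ) ^ 2 * Cw * Zl (d + 1) (δW - R) ^ 2)
          ((Fintype.card (Fib d) : ℝ) * cA * Zl (d + 1) (δK - R))
          ((Fintype.card (Fib d) : ℝ) * cK * Zl (d + 1) (δK - R) * ((Fintype.card (Fib d) : ℝ) ^ 2 * Cs * Zl (d + 1) (δS - R / 2) ^ 2) +
            (Fintype.card (Fib d) : ℝ) * C * Zl (d + 1) (δK - R) * ((Fintype.card (Fib d) : ℝ) ^ 2 * cS * Zl (d + 1) (δS - R / 2) ^ 2))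
          ((Fintype.card (Fib d) : ℝ) ^ 2 * cW * Zl (d + 1) (δW - R) ^ 2))
        (R * N)) θ := by
  have hRN : 0 < R * (N : ℝ) := mul_pos hR (by exact_mod_cast (show 0 < N by omega))
  exact fun k => LimitRate.abs_secondMoment_sub_limit_le (uniformDecay_hessKer_four hA hK hS hW hR hRK hRS hRW μ ν)
    (geometricRate_hessKer_four_lim hA hAinf hArate hK hKinf hKrate hS hSinf hSrate hW hWinf hWrate hR hRK hRS hRW μ ν) hRN hRN k

/-- [folklore] **THE TELESCOPED LIMIT KERNEL OF THE FOUR-FAMILY KERNEL IS THE KERNEL OF THE LIMIT FAMILIES**, entrywise in the `(μ,ν)`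
component (`0 ≤ θ < 1`; `LimitRate.GeometricRate.limKernelOf_eq`). -/
theorem limKernelOf_hessKer_four_apply
    (hA : ∀ k, Decays (A k) CA δK) (hAinf : Decays Ainf CA δK) (hArate : ∀ k, Decays (A k - Ainf) (cA * θ ^ k) δK)
    (hK : ∀ k, Decays (K k) C δK) (hKinf : Decays Kinf C δK) (hKrate : ∀ k, Decays (K k - Kinf) (cK * θ ^ k) δK)
    (hS : ∀ k, LocStencil (S k) Cs δS) (hSinf : LocStencil Sinf Cs δS) (hSrate : ∀ k, LocStencil (S k - Sinf) (cS * θ ^ k) δS)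
    (hW : ∀ k, VertexFamily₂ (W k) N Cw δW) (hWinf : VertexFamily₂ Winf N Cw δW)
    (hWrate : ∀ k, VertexFamily₂ (W k - Winf) N (cW * θ ^ k) δW)
    (hR : 0 < R) (hRK : R < δK) (hRS : R / 2 < δS) (hRW : R < δW) (hθ0 : 0 ≤ θ) (hθ1 : θ < 1) (μ ν : Fin (d + 1))
    (x : Fin (d + 1) → ℤ) :
    limKernelOf (fun k => hessKer (A k) (vertexOfK (K k) N (S k)) (W k)) μ ν x = hessKer Ainf (vertexOfK Kinf N Sinf) Winf μ ν x :=
  (geometricRate_hessKer_four_lim hA hAinf hArate hK hKinf hKrate hS hSinf hSrate hW hWinf hWrate hR hRK hRS hRW μ ν).limKernelOf_eq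
    hθ0 hθ1 x

end Four

/-! ## §3 Dimension four: the wall END for ANY step jet data with a four-family closed form, and the DIRECT form in any leg units -/

section Wall

variable {Lc : ℕ} [NeZero Lc] (Js : ℕ → JetData 3 Lc)
  {A K : ℕ → MKer (3 + 1) (Fib 3)} {Ainf Kinf : MKer (3 + 1) (Fib 3)}
  {S : ℕ → Fin (3 + 1) → (Fin (3 + 1) → ℤ) → MKer (3 + 1) (Fib 3)} {Sinf : Fin (3 + 1) → (Fin (3 + 1) → ℤ) → MKer (3 + 1) (Fib 3)}
  {W : ℕ → Fin (3 + 1) → (Fin (3 + 1) → ℤ) → Fin (3 + 1) → (Fin (3 + 1) → ℤ) → MKer (3 + 1) (Fib 3)}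
  {Winf : Fin (3 + 1) → (Fin (3 + 1) → ℤ) → Fin (3 + 1) → (Fin (3 + 1) → ℤ) → MKer (3 + 1) (Fib 3)}
  {R CA cA C cK δK Cs cS δS Cw cW δW θ : ℝ}

/-- [folklore] **(SW1)-SHAPE END OF THE WALL'S FAMILY FOR ANY JET DATA WITH A FOUR-FAMILY CLOSED FORM**, limit currency:
`GeomRate (j ↦ secondMoment (TbalOf Lc Js j) μ ν) (secondMoment (hessKer A∞ (vertexOfK K∞ Lc S∞) W∞) μ ν) c₀ θ`, `c₀ = betaPrime510 4 (lipW …) (R·Lc)`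
EXPLICIT.  NO range of `θ`; `hT` and every row are hypotheses. -/
theorem geomRate_secondMoment_TbalOf_four_lim (hT : ∀ j, TbalOf Lc Js j = hessKer (A j) (vertexOfK (K j) Lc (S j)) (W j))
    (hA : ∀ j, Decays (A j) CA δK) (hAinf : Decays Ainf CA δK) (hArate : ∀ j, Decays (A j - Ainf) (cA * θ ^ j) δK)
    (hK : ∀ j, Decays (K j) C δK) (hKinf : Decays Kinf C δK) (hKrate : ∀ j, Decays (K j - Kinf) (cK * θ ^ j) δK)
    (hS : ∀ j, LocStencil (S j) Cs δS) (hSinf : LocStencil Sinf Cs δS) (hSrate : ∀ j, LocStencil (S j - Sinf) (cS * θ ^ j) δS)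
    (hW : ∀ j, VertexFamily₂ (W j) Lc Cw δW) (hWinf : VertexFamily₂ Winf Lc Cw δW)
    (hWrate : ∀ j, VertexFamily₂ (W j - Winf) Lc (cW * θ ^ j) δW)
    (hR : 0 < R) (hRK : R < δK) (hRS : R / 2 < δS) (hRW : R < δW) (μ ν : Fin 4) :
    GeomRate (fun j => B12Beta.secondMoment (TbalOf Lc Js j) μ ν)
      (B12Beta.secondMoment (hessKer Ainf (vertexOfK Kinf Lc Sinf) Winf) μ ν)
      (betaPrime510 4
        (lipW ((Fintype.card (Fib 3) : ℝ) * CA * Zl 4 (δK - R))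
          ((Fintype.card (Fib 3) : ℝ) * CA * Zl 4 (δK - R))
          ((Fintype.card (Fib 3) : ℝ) * C * Zl 4 (δK - R) * ((Fintype.card (Fib 3) : ℝ) ^ 2 * Cs * Zl 4 (δS - R / 2) ^ 2))
          ((Fintype.card (Fib 3) : ℝ) * C * Zl 4 (δK - R) * ((Fintype.card (Fib 3) : ℝ) ^ 2 * Cs * Zl 4 (δS - R / 2) ^ 2))
          ((Fintype.card (Fib 3) : ℝ) ^ 2 * Cw * Zl 4 (δW - R) ^ 2)
          ((Fintype.card (Fib 3) : ℝ) * cA * Zl 4 (δK - R))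
          ((Fintype.card (Fib 3) : ℝ) * cK * Zl 4 (δK - R) * ((Fintype.card (Fib 3) : ℝ) ^ 2 * Cs * Zl 4 (δS - R / 2) ^ 2) +
            (Fintype.card (Fib 3) : ℝ) * C * Zl 4 (δK - R) * ((Fintype.card (Fib 3) : ℝ) ^ 2 * cS * Zl 4 (δS - R / 2) ^ 2))
          ((Fintype.card (Fib 3) : ℝ) ^ 2 * cW * Zl 4 (δW - R) ^ 2))
        (R * Lc)) θ := by
  have e : TbalOf Lc Js = fun j => hessKer (A j) (vertexOfK (K j) Lc (S j)) (W j) := funext hT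
  rw [e]
  exact geomRate_secondMoment_hessKer_four_lim one_le_Lc hA hAinf hArate hK hKinf hKrate hS hSinf hSrate hW hWinf hWrate hR hRK hRS
    hRW μ ν

/-- [folklore] **SCALAR ALL-SCALES END FOR ANY JET DATA WITH A FOUR-FAMILY CLOSED FORM** (`0 ≤ θ < 1`; asym2's `allScalesSeq_of_geomRate`):
`AllScalesSeq (j ↦ secondMoment (TbalOf Lc Js j) μ ν) κ θ`, `κ = c₀·(1 + θ)` EXPLICIT (two hops through the limit) — the input of
`HessKerDressedCauchy.pos_of_ge` (tail positivity from one certified value) and of `d1Drift_iff_lim_eq`. -/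
theorem allScalesSeq_secondMoment_TbalOf_four_lim (hT : ∀ j, TbalOf Lc Js j = hessKer (A j) (vertexOfK (K j) Lc (S j)) (W j))
    (hA : ∀ j, Decays (A j) CA δK) (hAinf : Decays Ainf CA δK) (hArate : ∀ j, Decays (A j - Ainf) (cA * θ ^ j) δK)
    (hK : ∀ j, Decays (K j) C δK) (hKinf : Decays Kinf C δK) (hKrate : ∀ j, Decays (K j - Kinf) (cK * θ ^ j) δK)
    (hS : ∀ j, LocStencil (S j) Cs δS) (hSinf : LocStencil Sinf Cs δS) (hSrate : ∀ j, LocStencil (S j - Sinf) (cS * θ ^ j) δS)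
    (hW : ∀ j, VertexFamily₂ (W j) Lc Cw δW) (hWinf : VertexFamily₂ Winf Lc Cw δW)
    (hWrate : ∀ j, VertexFamily₂ (W j - Winf) Lc (cW * θ ^ j) δW)
    (hR : 0 < R) (hRK : R < δK) (hRS : R / 2 < δS) (hRW : R < δW) (hθ0 : 0 ≤ θ) (hθ1 : θ < 1) (μ ν : Fin 4) :
    AllScalesSeq (fun j => B12Beta.secondMoment (TbalOf Lc Js j) μ ν)
      (betaPrime510 4
        (lipW ((Fintype.card (Fib 3) : ℝ) * CA * Zl 4 (δK - R))
          ((Fintype.card (Fib 3) : ℝ) * CA * Zl 4 (δK - R))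
          ((Fintype.card (Fib 3) : ℝ) * C * Zl 4 (δK - R) * ((Fintype.card (Fib 3) : ℝ) ^ 2 * Cs * Zl 4 (δS - R / 2) ^ 2))
          ((Fintype.card (Fib 3) : ℝ) * C * Zl 4 (δK - R) * ((Fintype.card (Fib 3) : ℝ) ^ 2 * Cs * Zl 4 (δS - R / 2) ^ 2))
          ((Fintype.card (Fib 3) : ℝ) ^ 2 * Cw * Zl 4 (δW - R) ^ 2)
          ((Fintype.card (Fib 3) : ℝ) * cA * Zl 4 (δK - R))
          ((Fintype.card (Fib 3) : ℝ) * cK * Zl 4 (δK - R) * ((Fintype.card (Fib 3) : ℝ) ^ 2 * Cs * Zl 4 (δS - R / 2) ^ 2) +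
            (Fintype.card (Fib 3) : ℝ) * C * Zl 4 (δK - R) * ((Fintype.card (Fib 3) : ℝ) ^ 2 * cS * Zl 4 (δS - R / 2) ^ 2))
          ((Fintype.card (Fib 3) : ℝ) ^ 2 * cW * Zl 4 (δW - R) ^ 2))
        (R * Lc) * (1 + θ)) θ :=
  allScalesSeq_of_geomRate (geomRate_secondMoment_TbalOf_four_lim Js hT hA hAinf hArate hK hKinf hKrate hS hSinf hSrate hW hWinf hWrate
    hR hRK hRS hRW μ ν) hθ0 hθ1.le

/-- [folklore] **THE WALL ⟺ THE EXPLICIT IDENTIFICATION FOR ANY JET DATA WITH A FOUR-FAMILY CLOSED FORM, LIMIT CURRENCY**: under `hT`, the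
rows against ANY named limits `(A∞, K∞, S∞, W∞)` and `0 ≤ θ < 1`,
`OneStepKernelFamily.D1Drift Lc Js N μ ν ↔ secondMoment (hessKer A∞ (vertexOfK K∞ Lc S∞) W∞) μ ν = B12Normalization.stepBal N Lc`
(`HessKerDressedCauchy.d1Drift_iff_lim_eq` + uniqueness of the limit value).  Discharges NOTHING. -/
theorem d1Drift_iff_of_lim_four (hT : ∀ j, TbalOf Lc Js j = hessKer (A j) (vertexOfK (K j) Lc (S j)) (W j))
    (hA : ∀ j, Decays (A j) CA δK) (hAinf : Decays Ainf CA δK) (hArate : ∀ j, Decays (A j - Ainf) (cA * θ ^ j) δK)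
    (hK : ∀ j, Decays (K j) C δK) (hKinf : Decays Kinf C δK) (hKrate : ∀ j, Decays (K j - Kinf) (cK * θ ^ j) δK)
    (hS : ∀ j, LocStencil (S j) Cs δS) (hSinf : LocStencil Sinf Cs δS) (hSrate : ∀ j, LocStencil (S j - Sinf) (cS * θ ^ j) δS)
    (hW : ∀ j, VertexFamily₂ (W j) Lc Cw δW) (hWinf : VertexFamily₂ Winf Lc Cw δW)
    (hWrate : ∀ j, VertexFamily₂ (W j - Winf) Lc (cW * θ ^ j) δW)
    (hR : 0 < R) (hRK : R < δK) (hRS : R / 2 < δS) (hRW : R < δW) (hθ0 : 0 ≤ θ) (hθ1 : θ < 1) (μ ν : Fin 4) (N : ℝ) :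
    D1Drift Lc Js N μ ν ↔ B12Beta.secondMoment (hessKer Ainf (vertexOfK Kinf Lc Sinf) Winf) μ ν = B12Normalization.stepBal N Lc := by
  have hG := geomRate_secondMoment_TbalOf_four_lim Js hT hA hAinf hArate hK hKinf hKrate hS hSinf hSrate hW hWinf hWrate hR hRK hRS hRW
    μ ν
  have hall := allScalesSeq_of_geomRate hG hθ0 hθ1.le
  have hlim : CauchyRate.lim (fun j => B12Beta.secondMoment (TbalOf Lc Js j) μ ν) =
      B12Beta.secondMoment (hessKer Ainf (vertexOfK Kinf Lc Sinf) Winf) μ ν :=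
    (hall.cauchyRate.eq_lim hθ1 (hG.tendsto hθ0 hθ1)).symm
  rw [d1Drift_iff_lim_eq Js hall hθ0 hθ1 N, hlim]

/-- [folklore] **THE TELESCOPED LIMIT KERNEL OF THE WALL'S FAMILY, EXPLICITLY, CAUCHY CURRENCY**: under `hT`, ALL-SCALES rows on the four
families and `0 ≤ θ < 1`, `limKernelOf (TbalOf Lc Js) μ ν x = hessKer A∞ (vertexOfK K∞ Lc S∞) W∞ μ ν x` at the CONSTRUCTED limits
`A∞ = limMKerOf A`, `K∞ = limMKerOf K`, `S∞ = limStOf S`, `W∞ = limTabOf W` (`HessKerDressedLimit` §1 closure lemmas). -/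
theorem limKernelOf_TbalOf_apply_four (hT : ∀ j, TbalOf Lc Js j = hessKer (A j) (vertexOfK (K j) Lc (S j)) (W j))
    (hA : ∀ j, Decays (A j) CA δK) (hAall : ∀ k j, Decays (A (k + j) - A k) (cA * θ ^ k) δK)
    (hK : ∀ j, Decays (K j) C δK) (hKall : ∀ k j, Decays (K (k + j) - K k) (cK * θ ^ k) δK)
    (hS : ∀ j, LocStencil (S j) Cs δS) (hSall : ∀ k j, LocStencil (S (k + j) - S k) (cS * θ ^ k) δS)
    (hW : ∀ j, VertexFamily₂ (W j) Lc Cw δW) (hWall : ∀ k j, VertexFamily₂ (W (k + j) - W k) Lc (cW * θ ^ k) δW)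
    (hR : 0 < R) (hRK : R < δK) (hRS : R / 2 < δS) (hRW : R < δW) (hθ0 : 0 ≤ θ) (hθ1 : θ < 1) (μ ν : Fin 4) (x : Fin 4 → ℤ) :
    limKernelOf (TbalOf Lc Js) μ ν x =
      hessKer (limMKerOf A) (vertexOfK (limMKerOf K) Lc (limStOf S)) (limTabOf W) μ ν x := by
  have e : TbalOf Lc Js = fun j => hessKer (A j) (vertexOfK (K j) Lc (S j)) (W j) := funext hT
  rw [e]
  exact limKernelOf_hessKer_four_apply (Ainf := limMKerOf A) (Kinf := limMKerOf K) (Sinf := limStOf S) (Winf := limTabOf W) hA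
    (decays_limMKerOf hA hAall hθ1) (decays_sub_limMKerOf hAall hθ1) hK (decays_limMKerOf hK hKall hθ1) (decays_sub_limMKerOf hKall hθ1)
    hS (locStencil_limStOf hS hSall hθ1) (locStencil_sub_limStOf hSall hθ1) hW (vertexFamily₂_limTabOf hW hWall hθ1)
    (vertexFamily₂_sub_limTabOf hWall hθ1) hR hRK hRS hRW hθ0 hθ1 μ ν x

/-- [folklore] **THE WALL ⟺ THE EXPLICIT IDENTIFICATION AT THE CONSTRUCTED LIMITS, CAUCHY CURRENCY**, for ANY jet data with a four-family
closed form: `k`-uniform rows + ALL-SCALES deviations (`Decays (A(k+j) − A k) (c_A θ^k) δK`, …) and `0 ≤ θ < 1` ⟹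
`D1Drift Lc Js N μ ν ↔ secondMoment (hessKer (limMKerOf A) (vertexOfK (limMKerOf K) Lc (limStOf S)) (limTabOf W)) μ ν = stepBal N Lc`. -/
theorem d1Drift_iff_of_cauchy_four (hT : ∀ j, TbalOf Lc Js j = hessKer (A j) (vertexOfK (K j) Lc (S j)) (W j))
    (hA : ∀ j, Decays (A j) CA δK) (hAall : ∀ k j, Decays (A (k + j) - A k) (cA * θ ^ k) δK)
    (hK : ∀ j, Decays (K j) C δK) (hKall : ∀ k j, Decays (K (k + j) - K k) (cK * θ ^ k) δK)
    (hS : ∀ j, LocStencil (S j) Cs δS) (hSall : ∀ k j, LocStencil (S (k + j) - S k) (cS * θ ^ k) δS)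
    (hW : ∀ j, VertexFamily₂ (W j) Lc Cw δW) (hWall : ∀ k j, VertexFamily₂ (W (k + j) - W k) Lc (cW * θ ^ k) δW)
    (hR : 0 < R) (hRK : R < δK) (hRS : R / 2 < δS) (hRW : R < δW) (hθ0 : 0 ≤ θ) (hθ1 : θ < 1) (μ ν : Fin 4) (N : ℝ) :
    D1Drift Lc Js N μ ν ↔
      B12Beta.secondMoment (hessKer (limMKerOf A) (vertexOfK (limMKerOf K) Lc (limStOf S)) (limTabOf W)) μ ν =
        B12Normalization.stepBal N Lc :=
  d1Drift_iff_of_lim_four Js (Ainf := limMKerOf A) (Kinf := limMKerOf K) (Sinf := limStOf S) (Winf := limTabOf W) hT hA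
    (decays_limMKerOf hA hAall hθ1) (decays_sub_limMKerOf hAall hθ1) hK (decays_limMKerOf hK hKall hθ1) (decays_sub_limMKerOf hKall hθ1)
    hS (locStencil_limStOf hS hSall hθ1) (locStencil_sub_limStOf hSall hθ1) hW (vertexFamily₂_limTabOf hW hWall hθ1)
    (vertexFamily₂_sub_limTabOf hWall hθ1) hR hRK hRS hRW hθ0 hθ1 μ ν N

end Wall

section Direct

variable {Lc : ℕ} [NeZero Lc] (Js : ℕ → JetData 3 Lc) (sf sm : ℕ → ℝ) {R C cK δK Cs cS δS Cw cW δW θ : ℝ}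

/-- [folklore] **THE WALL'S KERNELS ARE A THREE-FAMILY FORM BY DEFINITION** (`OneStepKernelFamily.TstepOf`): for ANY step jet data,
`TbalOf Lc Js j = hessKer K_j (vertexOfK K_j Lc (Js j).S) (Js j).W`, `K_j = KInvStep Lc j` — whatever dressing produced `Js`. -/
theorem TbalOf_apply (j : ℕ) :
    TbalOf Lc Js j = hessKer (KInvStep (d := 3) Lc j) (vertexOfK (KInvStep (d := 3) Lc j) Lc (Js j).S) (Js j).W := rfl

/-- [folklore] **… IN ANY LEG UNITS** (`HessKerDressedUnits.hessKer_vertexOfK_unit`): for nonzero `s_f j, s_m j`,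
`TbalOf Lc Js j = hessKer (D_j K_j D_j) (vertexOfK (D_j K_j D_j) Lc (unitS_j (Js j).S)) (unitW_j (Js j).W)`. -/
theorem TbalOf_apply_unit (hsf : ∀ j, sf j ≠ 0) (hsm : ∀ j, sm j ≠ 0) (j : ℕ) :
    TbalOf Lc Js j = hessKer (unitK (sf j) (sm j) (KInvStep (d := 3) Lc j))
      (vertexOfK (unitK (sf j) (sm j) (KInvStep (d := 3) Lc j)) Lc (unitS (sf j) (sm j) (Js j).S)) (unitW (sf j) (sm j) (Js j).W) := by
  rw [TbalOf_apply]
  exact (hessKer_vertexOfK_unit (hsf j) (hsm j) Lc (KInvStep (d := 3) Lc j) (Js j).S (Js j).W).symm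

/-- [folklore] **THE WALL ⟺ THE EXPLICIT IDENTIFICATION, FOR ARBITRARY STEP JET DATA, CAUCHY CURRENCY, ANY LEG UNITS.**  For ANY
`Js : ℕ → JetData 3 Lc` (any dressing, any root) and ANY nonzero unit sequences: `j`-uniform rows + all-scales deviations with rate `θ` of the
RESCALED RESOLVENTS `D_j K_j D_j` (EXACTLY the K-slot binders of `HessKerDressedUnitsWall.d1Drift_JsBalOf_iff_of_cauchy_unit`), of the jet data's
OWN RESCALED STENCILS `unitS_j (Js j).S` and OWN RESCALED TABLES `unitW_j (Js j).W`, and `0 ≤ θ < 1` ⟹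
`D1Drift Lc Js N μ ν ↔ secondMoment (hessKer K∞ (vertexOfK K∞ Lc S∞) W∞) μ ν = stepBal N Lc` at the CONSTRUCTED limits of the three rescaled
families.  No dressing lemma is used.  Discharges NOTHING. -/
theorem d1Drift_iff_of_cauchy_self_unit (hsf : ∀ j, sf j ≠ 0) (hsm : ∀ j, sm j ≠ 0)
    (hK : ∀ j, Decays (unitK (sf j) (sm j) (KInvStep (d := 3) Lc j)) C δK)
    (hKall : ∀ k j, Decays (unitK (sf (k + j)) (sm (k + j)) (KInvStep (d := 3) Lc (k + j)) -
      unitK (sf k) (sm k) (KInvStep (d := 3) Lc k)) (cK * θ ^ k) δK)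
    (hS : ∀ j, LocStencil (unitS (sf j) (sm j) (Js j).S) Cs δS)
    (hSall : ∀ k j, LocStencil (unitS (sf (k + j)) (sm (k + j)) (Js (k + j)).S - unitS (sf k) (sm k) (Js k).S) (cS * θ ^ k) δS)
    (hW : ∀ j, VertexFamily₂ (unitW (sf j) (sm j) (Js j).W) Lc Cw δW)
    (hWall : ∀ k j, VertexFamily₂ (unitW (sf (k + j)) (sm (k + j)) (Js (k + j)).W - unitW (sf k) (sm k) (Js k).W) Lc (cW * θ ^ k) δW)
    (hR : 0 < R) (hRK : R < δK) (hRS : R / 2 < δS) (hRW : R < δW) (hθ0 : 0 ≤ θ) (hθ1 : θ < 1) (μ ν : Fin 4) (N : ℝ) :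
    D1Drift Lc Js N μ ν ↔
      B12Beta.secondMoment (hessKer (limMKerOf fun j => unitK (sf j) (sm j) (KInvStep (d := 3) Lc j))
        (vertexOfK (limMKerOf fun j => unitK (sf j) (sm j) (KInvStep (d := 3) Lc j)) Lc (limStOf fun j => unitS (sf j) (sm j) (Js j).S))
        (limTabOf fun j => unitW (sf j) (sm j) (Js j).W)) μ ν = B12Normalization.stepBal N Lc :=
  d1Drift_iff_of_cauchy_four Js (A := fun j => unitK (sf j) (sm j) (KInvStep (d := 3) Lc j))
    (K := fun j => unitK (sf j) (sm j) (KInvStep (d := 3) Lc j)) (S := fun j => unitS (sf j) (sm j) (Js j).S)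
    (W := fun j => unitW (sf j) (sm j) (Js j).W) (TbalOf_apply_unit Js sf sm hsf hsm) hK hKall hK hKall hS hSall hW hWall hR hRK hRS hRW
    hθ0 hθ1 μ ν N

end Direct

end Summit.QuantumFields.BalabanUV.Beta.HessKerFourFamily
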